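import Summits.QuantumAdvantage.QuantumAdvantage.Theorems.CubicForrelationNearExactIsExactCubicFormR4PartnerLevelTables
import Summits.QuantumAdvantage.QuantumAdvantage.Theorems.CubicForrelationNearExactIsExactCubicFormCellL6

/-!
# Crux `CubicForrelation.NearExactIsExact` (stmt-QuantumAdvantage-14043) — E1280-even, R4 branch, levels `HL h`: the TEN CELLS in normal
  coordinates (common preamble of the descendants `T` and `x₁q₄`)

Certificate seat `b2b-cforr-cert` (gen 42).  HONEST FRAMING: kernel-checked glue (standard axioms).  Inside `HL h` of
…CubicFormR4PartnerDispatch (light cell `vc` with third differences in the normal form `s₀ ∧ ω_{2h}`), `tpw_R4_level_cells` provides what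
R4-PARTNER.md §5–6 start from: the index maps `lo, hi` (`tpw_R4_level_tables`), the normal form for EVERY cell prefix `p ∈ 𝔽₂⁵`
(`tpw_R4_cells_share`), the tables of `d` on the `z`-block, the budget `Σ_{v ∈ Z₁₀} #f_v ≤ 255` (`tc5_weight` + `#κ < 1280`), and for every
cell `v ∈ 𝔽₂⁴`: `#f_v ≥ 32 − 2^(5−h)`, and `#f_v < 32 ⇒ #f_v = 32 − 2^(5−h)` with a vanishing `s₀`-half (`tl6_cell_light`).  Hence (h = 1) every
cell weighs `≥ 16` and (h = 2) `≥ 24`, so at least `5` resp. `9` cells of `Z₁₀` are exact.  Nothing about `θ₁₂`; NOT summit progress.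

References: this seat lineage (g37 R4-PARTNER §5–6).  Axioms: the standard three.
-/

set_option linter.dupNamespace false -- D-0017: single-problem summit ⇒ `QuantumAdvantage.QuantumAdvantage` by design

namespace Summit.QuantumAdvantage.QuantumAdvantage.Theorems.CubicForrelation.NearExactIsExact

open Finset
open Literature.Computability.QuantumComplexity
open Literature.Computability.QuantumComplexity.BuzetChailloux (bxor zeroVec bxor_comm bxor_self bxor_zeroVec zeroVec_bxor
  bxor_bxor_cancel_left)

/-- **The ten cells at level `h`.**  See the module docstring. [this work] -/
theorem tpw_R4_level_cells (κ : (Fin (5 + 7) → Bool) → Bool) (hκ : IsDegLeFun 3 κ)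
    (d : Fin (5 + 7) → Fin (5 + 7) → Fin (5 + 7) → ZMod 2)
    (hd : ∀ φ j k, d φ j k =
      if ((((κ zeroVec ^^ κ (bxor zeroVec (fun l => decide (l = k)))) ^^
              (κ (bxor zeroVec (fun l => decide (l = j))) ^^ κ (bxor (bxor zeroVec (fun l => decide (l = j))) (fun l => decide (l = k))))) ^^
            ((κ (bxor zeroVec (fun l => decide (l = φ))) ^^ κ (bxor (bxor zeroVec (fun l => decide (l = φ))) (fun l => decide (l = k)))) ^^
              (κ (bxor (bxor zeroVec (fun l => decide (l = φ))) (fun l => decide (l = j))) ^^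
                κ (bxor (bxor (bxor zeroVec (fun l => decide (l = φ))) (fun l => decide (l = j))) (fun l => decide (l = k))))))) = true
      then 1 else 0)
    (hD : ∀ y, (κ y ^^ κ (bxor y (fun l => decide (l = Fin.castAdd 7 (0 : Fin 5))))) =
      ((y (Fin.castAdd 7 (1 : Fin 5)) && y (Fin.castAdd 7 (2 : Fin 5))) ^^ (y (Fin.castAdd 7 (3 : Fin 5)) && y (Fin.castAdd 7 (4 : Fin 5)))))
    (hlt : #(univ.filter fun y : Fin (5 + 7) → Bool => κ y = true) < 1280)
    (h : ℕ) (hk : 1 + h + h ≤ 7) (h1 : 1 ≤ h) (h2 : h ≤ 2) (vc : Fin 4 → Bool)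
    (hT : (∀ u v w x : Fin 7 → Bool,
      ((((κ (Fin.append (Matrix.vecCons false vc) x) ^^ κ (Fin.append (Matrix.vecCons false vc) (bxor x w))) ^^
              (κ (Fin.append (Matrix.vecCons false vc) (bxor x v)) ^^ κ (Fin.append (Matrix.vecCons false vc) (bxor (bxor x v) w)))) ^^
            ((κ (Fin.append (Matrix.vecCons false vc) (bxor x u)) ^^ κ (Fin.append (Matrix.vecCons false vc) (bxor (bxor x u) w))) ^^
              (κ (Fin.append (Matrix.vecCons false vc) (bxor (bxor x u) v)) ^^
                κ (Fin.append (Matrix.vecCons false vc) (bxor (bxor (bxor x u) v) w)))))) =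
      ((((u (Fin.castLE hk (Fin.castAdd h (Fin.castAdd h (0 : Fin 1)))) &&
            decide ((∑ ii : Fin h, ((if v (Fin.castLE hk (Fin.castAdd h (Fin.natAdd 1 ii))) = true then (1 : ZMod 2) else 0) * (if w (Fin.castLE hk (Fin.natAdd (1 + h) ii)) = true then (1 : ZMod 2) else 0) +
              (if v (Fin.castLE hk (Fin.natAdd (1 + h) ii)) = true then (1 : ZMod 2) else 0) * (if w (Fin.castLE hk (Fin.castAdd h (Fin.natAdd 1 ii))) = true then (1 : ZMod 2) else 0))) = 1)) ^^
          (v (Fin.castLE hk (Fin.castAdd h (Fin.castAdd h (0 : Fin 1)))) &&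
            decide ((∑ ii : Fin h, ((if u (Fin.castLE hk (Fin.castAdd h (Fin.natAdd 1 ii))) = true then (1 : ZMod 2) else 0) * (if w (Fin.castLE hk (Fin.natAdd (1 + h) ii)) = true then (1 : ZMod 2) else 0) +
              (if u (Fin.castLE hk (Fin.natAdd (1 + h) ii)) = true then (1 : ZMod 2) else 0) * (if w (Fin.castLE hk (Fin.castAdd h (Fin.natAdd 1 ii))) = true then (1 : ZMod 2) else 0))) = 1))) ^^
          (w (Fin.castLE hk (Fin.castAdd h (Fin.castAdd h (0 : Fin 1)))) &&
            decide ((∑ ii : Fin h, ((if u (Fin.castLE hk (Fin.castAdd h (Fin.natAdd 1 ii))) = true then (1 : ZMod 2) else 0) * (if v (Fin.castLE hk (Fin.natAdd (1 + h) ii)) = true then (1 : ZMod 2) else 0) +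
              (if u (Fin.castLE hk (Fin.natAdd (1 + h) ii)) = true then (1 : ZMod 2) else 0) * (if v (Fin.castLE hk (Fin.castAdd h (Fin.natAdd 1 ii))) = true then (1 : ZMod 2) else 0))) = 1)))))) :
    ∃ (lo hi : Fin h → Fin 6),
      Function.Injective lo ∧ Function.Injective hi ∧ (∀ a b, lo a ≠ hi b) ∧
      (∀ a, (lo a).val = a.val) ∧ (∀ a, (hi a).val = h + a.val) ∧
      (∀ (p : Fin 5 → Bool) (u v w x : Fin (1 + 6) → Bool),
        ((((κ (Fin.append p x) ^^ κ (Fin.append p (bxor x w))) ^^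
            (κ (Fin.append p (bxor x v)) ^^ κ (Fin.append p (bxor (bxor x v) w)))) ^^
          ((κ (Fin.append p (bxor x u)) ^^ κ (Fin.append p (bxor (bxor x u) w))) ^^
            (κ (Fin.append p (bxor (bxor x u) v)) ^^
              κ (Fin.append p (bxor (bxor (bxor x u) v) w)))))) =
        ((((u (Fin.castAdd 6 (0 : Fin 1)) &&
            decide ((∑ ii : Fin h, ((if (fun jj => v (Fin.natAdd 1 jj)) (lo ii) = true then (1 : ZMod 2) else 0) * (if (fun jj => w (Fin.natAdd 1 jj)) (hi ii) = true then (1 : ZMod 2) else 0) +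
              (if (fun jj => v (Fin.natAdd 1 jj)) (hi ii) = true then (1 : ZMod 2) else 0) * (if (fun jj => w (Fin.natAdd 1 jj)) (lo ii) = true then (1 : ZMod 2) else 0))) = 1)) ^^
          (v (Fin.castAdd 6 (0 : Fin 1)) &&
            decide ((∑ ii : Fin h, ((if (fun jj => u (Fin.natAdd 1 jj)) (lo ii) = true then (1 : ZMod 2) else 0) * (if (fun jj => w (Fin.natAdd 1 jj)) (hi ii) = true then (1 : ZMod 2) else 0) +
              (if (fun jj => u (Fin.natAdd 1 jj)) (hi ii) = true then (1 : ZMod 2) else 0) * (if (fun jj => w (Fin.natAdd 1 jj)) (lo ii) = true then (1 : ZMod 2) else 0))) = 1))) ^^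
          (w (Fin.castAdd 6 (0 : Fin 1)) &&
            decide ((∑ ii : Fin h, ((if (fun jj => u (Fin.natAdd 1 jj)) (lo ii) = true then (1 : ZMod 2) else 0) * (if (fun jj => v (Fin.natAdd 1 jj)) (hi ii) = true then (1 : ZMod 2) else 0) +
              (if (fun jj => u (Fin.natAdd 1 jj)) (hi ii) = true then (1 : ZMod 2) else 0) * (if (fun jj => v (Fin.natAdd 1 jj)) (lo ii) = true then (1 : ZMod 2) else 0))) = 1))))) ∧
      (∀ s u : Fin (1 + 6), d (Fin.natAdd 5 (Fin.castAdd 6 (0 : Fin 1))) (Fin.natAdd 5 s) (Fin.natAdd 5 u) =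
        ∑ q, (if (s = Fin.natAdd 1 (lo q) ∧ u = Fin.natAdd 1 (hi q)) ∨ (s = Fin.natAdd 1 (hi q) ∧ u = Fin.natAdd 1 (lo q))
          then (1 : ZMod 2) else 0)) ∧
      (∀ q (s u : Fin (1 + 6)), d (Fin.natAdd 5 (Fin.natAdd 1 (lo q))) (Fin.natAdd 5 s) (Fin.natAdd 5 u) =
        if (s = Fin.castAdd 6 (0 : Fin 1) ∧ u = Fin.natAdd 1 (hi q)) ∨ (s = Fin.natAdd 1 (hi q) ∧ u = Fin.castAdd 6 (0 : Fin 1)) then 1 else 0) ∧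
      (∀ q (s u : Fin (1 + 6)), d (Fin.natAdd 5 (Fin.natAdd 1 (hi q))) (Fin.natAdd 5 s) (Fin.natAdd 5 u) =
        if (s = Fin.castAdd 6 (0 : Fin 1) ∧ u = Fin.natAdd 1 (lo q)) ∨ (s = Fin.natAdd 1 (lo q) ∧ u = Fin.castAdd 6 (0 : Fin 1)) then 1 else 0) ∧
      #(univ.filter fun s : Fin 7 → Bool => κ (Fin.append (Matrix.vecCons false ![false, false, false, false]) s) = true) +
        #(univ.filter fun s : Fin 7 → Bool => κ (Fin.append (Matrix.vecCons false ![false, false, false, true]) s) = true) +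
        #(univ.filter fun s : Fin 7 → Bool => κ (Fin.append (Matrix.vecCons false ![false, false, true, false]) s) = true) +
        #(univ.filter fun s : Fin 7 → Bool => κ (Fin.append (Matrix.vecCons false ![false, true, false, false]) s) = true) +
        #(univ.filter fun s : Fin 7 → Bool => κ (Fin.append (Matrix.vecCons false ![false, true, false, true]) s) = true) +
        #(univ.filter fun s : Fin 7 → Bool => κ (Fin.append (Matrix.vecCons false ![false, true, true, false]) s) = true) +
        #(univ.filter fun s : Fin 7 → Bool => κ (Fin.append (Matrix.vecCons false ![true, false, false, false]) s) = true) +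
        #(univ.filter fun s : Fin 7 → Bool => κ (Fin.append (Matrix.vecCons false ![true, false, false, true]) s) = true) +
        #(univ.filter fun s : Fin 7 → Bool => κ (Fin.append (Matrix.vecCons false ![true, false, true, false]) s) = true) +
        #(univ.filter fun s : Fin 7 → Bool => κ (Fin.append (Matrix.vecCons false ![true, true, true, true]) s) = true) ≤ 255 ∧
      (∀ v : Fin 4 → Bool,
        32 ≤ #(univ.filter fun s : Fin 7 → Bool => κ (Fin.append (Matrix.vecCons false v) s) = true) + 2 ^ (5 - h) ∧
        (#(univ.filter fun s : Fin 7 → Bool => κ (Fin.append (Matrix.vecCons false v) s) = true) < 32 →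
          #(univ.filter fun s : Fin 7 → Bool => κ (Fin.append (Matrix.vecCons false v) s) = true) + 2 ^ (5 - h) = 32 ∧
          ((∀ s' : Fin 6 → Bool, κ (Fin.append (Matrix.vecCons false v) (Fin.append ![false] s')) = false) ∨
           (∀ s' : Fin 6 → Bool, κ (Fin.append (Matrix.vecCons false v) (Fin.append ![true] s')) = false)))) := by
  obtain ⟨lo, hi, hlo, hhi, hlohi, hlov, hhiv, hT', t0, tlo, thi⟩ :=
    tpw_R4_level_tables κ hκ d hd (Matrix.vecCons false vc) h hk hT
  have hshare : ∀ (p : Fin 5 → Bool) (u v w x : Fin (1 + 6) → Bool),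
      ((((κ (Fin.append p x) ^^ κ (Fin.append p (bxor x w))) ^^
            (κ (Fin.append p (bxor x v)) ^^ κ (Fin.append p (bxor (bxor x v) w)))) ^^
          ((κ (Fin.append p (bxor x u)) ^^ κ (Fin.append p (bxor (bxor x u) w))) ^^
            (κ (Fin.append p (bxor (bxor x u) v)) ^^
              κ (Fin.append p (bxor (bxor (bxor x u) v) w)))))) =
      ((((u (Fin.castAdd 6 (0 : Fin 1)) &&
            decide ((∑ ii : Fin h, ((if (fun jj => v (Fin.natAdd 1 jj)) (lo ii) = true then (1 : ZMod 2) else 0) * (if (fun jj => w (Fin.natAdd 1 jj)) (hi ii) = true then (1 : ZMod 2) else 0) +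
              (if (fun jj => v (Fin.natAdd 1 jj)) (hi ii) = true then (1 : ZMod 2) else 0) * (if (fun jj => w (Fin.natAdd 1 jj)) (lo ii) = true then (1 : ZMod 2) else 0))) = 1)) ^^
          (v (Fin.castAdd 6 (0 : Fin 1)) &&
            decide ((∑ ii : Fin h, ((if (fun jj => u (Fin.natAdd 1 jj)) (lo ii) = true then (1 : ZMod 2) else 0) * (if (fun jj => w (Fin.natAdd 1 jj)) (hi ii) = true then (1 : ZMod 2) else 0) +
              (if (fun jj => u (Fin.natAdd 1 jj)) (hi ii) = true then (1 : ZMod 2) else 0) * (if (fun jj => w (Fin.natAdd 1 jj)) (lo ii) = true then (1 : ZMod 2) else 0))) = 1))) ^^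
          (w (Fin.castAdd 6 (0 : Fin 1)) &&
            decide ((∑ ii : Fin h, ((if (fun jj => u (Fin.natAdd 1 jj)) (lo ii) = true then (1 : ZMod 2) else 0) * (if (fun jj => v (Fin.natAdd 1 jj)) (hi ii) = true then (1 : ZMod 2) else 0) +
              (if (fun jj => u (Fin.natAdd 1 jj)) (hi ii) = true then (1 : ZMod 2) else 0) * (if (fun jj => v (Fin.natAdd 1 jj)) (lo ii) = true then (1 : ZMod 2) else 0))) = 1)))) := fun p =>
    tpw_R4_cells_share κ hκ (Matrix.vecCons false vc) p
      (fun u v w => ((((u (Fin.castAdd 6 (0 : Fin 1)) &&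
            decide ((∑ ii : Fin h, ((if (fun jj => v (Fin.natAdd 1 jj)) (lo ii) = true then (1 : ZMod 2) else 0) * (if (fun jj => w (Fin.natAdd 1 jj)) (hi ii) = true then (1 : ZMod 2) else 0) +
              (if (fun jj => v (Fin.natAdd 1 jj)) (hi ii) = true then (1 : ZMod 2) else 0) * (if (fun jj => w (Fin.natAdd 1 jj)) (lo ii) = true then (1 : ZMod 2) else 0))) = 1)) ^^
          (v (Fin.castAdd 6 (0 : Fin 1)) &&
            decide ((∑ ii : Fin h, ((if (fun jj => u (Fin.natAdd 1 jj)) (lo ii) = true then (1 : ZMod 2) else 0) * (if (fun jj => w (Fin.natAdd 1 jj)) (hi ii) = true then (1 : ZMod 2) else 0) +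
              (if (fun jj => u (Fin.natAdd 1 jj)) (hi ii) = true then (1 : ZMod 2) else 0) * (if (fun jj => w (Fin.natAdd 1 jj)) (lo ii) = true then (1 : ZMod 2) else 0))) = 1))) ^^
          (w (Fin.castAdd 6 (0 : Fin 1)) &&
            decide ((∑ ii : Fin h, ((if (fun jj => u (Fin.natAdd 1 jj)) (lo ii) = true then (1 : ZMod 2) else 0) * (if (fun jj => v (Fin.natAdd 1 jj)) (hi ii) = true then (1 : ZMod 2) else 0) +
              (if (fun jj => u (Fin.natAdd 1 jj)) (hi ii) = true then (1 : ZMod 2) else 0) * (if (fun jj => v (Fin.natAdd 1 jj)) (lo ii) = true then (1 : ZMod 2) else 0))) = 1))))) hT'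
  refine ⟨lo, hi, hlo, hhi, hlohi, hlov, hhiv, hshare, t0, tlo, thi, ?_, ?_⟩
  · have hwt := tc5_weight κ hD
    have h128 : (2 : ℕ) ^ 7 = 128 := by norm_num
    rw [h128] at hwt
    omega
  · intro v
    have L := tl6_cell_light (fun s : Fin (1 + 6) → Bool => κ (Fin.append (Matrix.vecCons false v) s)) h h1 (by omega) lo hi hlo hhi hlohi
      (fun a b : Fin 6 → Bool => decide ((∑ ii : Fin h, ((if a (lo ii) = true then (1 : ZMod 2) else 0) * (if b (hi ii) = true then (1 : ZMod 2) else 0) +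
        (if a (hi ii) = true then (1 : ZMod 2) else 0) * (if b (lo ii) = true then (1 : ZMod 2) else 0))) = 1))
      (fun a b => rfl) (hshare (Matrix.vecCons false v))
    exact L

end Summit.QuantumAdvantage.QuantumAdvantage.Theorems.CubicForrelation.NearExactIsExact
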